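import Summits.CriticalPhenomena.PercolationContinuityZ3.Theorems.PercNearOneGluingNoHeavyLowerTailIncStarRootStarTwoStep
import Literature.Probability.LatticeModels.ProdBernoulliCoupling
import Mathlib.Combinatorics.SetFamily.FourFunctions
import HarnessLib

/-!
# Harris' inequality on the root cube (the pinning mixture is positively correlated)

Support file for the Sahi programme (`--supports stmt-CriticalPhenomena-4575`, prover prim-sahi-p2 gen 16).  No definitions, no named
facts, no sorries; standard axioms.

In the vocabulary of `IncStar.incStar_nonneg_of_rootStarMixture` / `…_of_twoStep`: for a finite set `F` of pairs, `O ⊆ F`, the pinned weight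
`w^O = (1 on O, 0 on F ∖ O, w elsewhere)` and `π(O) = Π_{e∈O} w e · Π_{e∈F∖O}(1 − w e)`, the map `O ↦ x_O(A) := P_{w^O}(A)` is nondecreasing for every
increasing event `A` (more surely-open pairs), and `π` is a product weight on the Boolean lattice of subsets of `F` (log-modular).  Hence, by the
FKG inequality on a finite distributive lattice (Mathlib's `fkg`, here in its Harris/product form), the mixture moments of two increasing events are
positively correlated:

  `(Σ_O π(O) x_O(A)) · (Σ_O π(O) x_O(B)) ≤ Σ_O π(O) x_O(A) x_O(B)`     (`rootCube_harris`),

i.e. `Cov_π(m_A, m_B) ≥ 0` in the cube notation of the memo (`run/shared/lean/prim/prim-sahi/FROM-prim-sahi-p2-gen16-CURVATURE-MAP-SHARP-FORM.md` §(D)).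
This is the basic tool for every cube-covariance statement of the (MQ) programme (e.g. `Cov_π(m_a, m_bc) ≥ 0`, the Harris part of the two-step split).
-/

noncomputable section

namespace Summit.CriticalPhenomena.PercolationContinuityZ3.Theorems

namespace IncStar

open Finset MeasureTheory Literature.Probability.Percolation Literature.Probability.LatticeModels EdgeInduction
open scoped Classical

variable {n : ℕ}

/-- Pinning more pairs to `1` raises the pinned weight pointwise. [folklore] -/
theorem pin_le_pin_of_subset (w : Sym2 (Fin n) → unitInterval) (F : Finset (Sym2 (Fin n))) {O O' : Finset (Sym2 (Fin n))} (h : O ⊆ O') :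
    (fun f => if f ∈ O then (1 : unitInterval) else if f ∈ F then 0 else w f) ≤
      (fun f => if f ∈ O' then (1 : unitInterval) else if f ∈ F then 0 else w f) := by
  intro f
  by_cases h1 : f ∈ O
  · simp only [h1, h h1, if_true, le_refl]
  · by_cases h2 : f ∈ O'
    · simp only [h1, h2, if_false, if_true]
      exact unitInterval.le_one _
    · simp only [h1, h2, if_false, le_refl]

/-- The pinned probability of an increasing event is nondecreasing in the pinned set. [folklore] -/
theorem real_pin_mono (w : Sym2 (Fin n) → unitInterval) (F : Finset (Sym2 (Fin n))) {A : Set (BondConfig (Fin n))} (hA : IsUpperSet A)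
    {O O' : Finset (Sym2 (Fin n))} (h : O ⊆ O') :
    (prodBernoulli (fun f => if f ∈ O then (1 : unitInterval) else if f ∈ F then 0 else w f)).real A ≤
      (prodBernoulli (fun f => if f ∈ O' then (1 : unitInterval) else if f ∈ F then 0 else w f)).real A :=
  prodBernoulli_real_mono_of_isUpperSet (pin_le_pin_of_subset w F h) hA MeasurableSet.of_discrete

/-- The mixture weight as one product over `F`. [folklore] -/
theorem mixtureWeight_eq_prod_ite (w : Sym2 (Fin n) → unitInterval) {F O : Finset (Sym2 (Fin n))} (hO : O ⊆ F) :
    (∏ f ∈ O, (w f : ℝ)) * (∏ f ∈ F \ O, (1 - (w f : ℝ))) = ∏ f ∈ F, (if f ∈ O then (w f : ℝ) else 1 - (w f : ℝ)) := by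
  rw [Finset.prod_ite]
  have e1 : F.filter (fun f => f ∈ O) = O := by
    ext f; simp only [Finset.mem_filter]; exact ⟨fun h => h.2, fun h => ⟨hO h, h⟩⟩
  have e2 : F.filter (fun f => ¬ f ∈ O) = F \ O := by
    ext f; simp only [Finset.mem_filter, Finset.mem_sdiff]
  rw [e1, e2]

/-- Product weights on the Boolean lattice are log-modular: `π(a) π(b) = π(a ∩ b) π(a ∪ b)`. [folklore] -/
theorem mixtureWeight_mul_eq (w : Sym2 (Fin n) → unitInterval) {F a b : Finset (Sym2 (Fin n))} (ha : a ⊆ F) (hb : b ⊆ F) :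
    ((∏ f ∈ a, (w f : ℝ)) * ∏ f ∈ F \ a, (1 - (w f : ℝ))) * ((∏ f ∈ b, (w f : ℝ)) * ∏ f ∈ F \ b, (1 - (w f : ℝ))) =
      ((∏ f ∈ a ∩ b, (w f : ℝ)) * ∏ f ∈ F \ (a ∩ b), (1 - (w f : ℝ))) *
        ((∏ f ∈ a ∪ b, (w f : ℝ)) * ∏ f ∈ F \ (a ∪ b), (1 - (w f : ℝ))) := by
  rw [mixtureWeight_eq_prod_ite w ha, mixtureWeight_eq_prod_ite w hb,
    mixtureWeight_eq_prod_ite w (Finset.inter_subset_left.trans ha), mixtureWeight_eq_prod_ite w (Finset.union_subset ha hb),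
    ← Finset.prod_mul_distrib, ← Finset.prod_mul_distrib]
  refine Finset.prod_congr rfl fun f _ => ?_
  by_cases h1 : f ∈ a
  · by_cases h2 : f ∈ b
    · rw [if_pos h1, if_pos h2, if_pos (Finset.mem_inter.2 ⟨h1, h2⟩), if_pos (Finset.mem_union.2 (Or.inl h1))]
    · rw [if_pos h1, if_neg h2, if_neg (fun h => h2 (Finset.mem_inter.1 h).2), if_pos (Finset.mem_union.2 (Or.inl h1))]
      ring
  · by_cases h2 : f ∈ b
    · rw [if_neg h1, if_pos h2, if_neg (fun h => h1 (Finset.mem_inter.1 h).1), if_pos (Finset.mem_union.2 (Or.inr h2))]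
    · rw [if_neg h1, if_neg h2, if_neg (fun h => h1 (Finset.mem_inter.1 h).1),
        if_neg (fun h => (Finset.mem_union.1 h).elim h1 h2)]

/-- The mixture weights sum to one. [folklore] -/
theorem sum_mixtureWeight_eq_one (w : Sym2 (Fin n) → unitInterval) (F : Finset (Sym2 (Fin n))) :
    ∑ O ∈ F.powerset, (∏ f ∈ O, (w f : ℝ)) * (∏ f ∈ F \ O, (1 - (w f : ℝ))) = 1 := by
  have h := real_eq_sum_rootStarMixture w F Set.univ
  simp only [probReal_univ, mul_one] at h
  exact h.symm

/-- **Harris' inequality on the root cube.**  For increasing events `A, B` the mixture moments are positively correlated: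
`(Σ_O π(O) x_O(A))·(Σ_O π(O) x_O(B)) ≤ Σ_O π(O) x_O(A) x_O(B)` (FKG on the Boolean lattice of pinned sets, Mathlib's `fkg`). [folklore] -/
theorem rootCube_harris (w : Sym2 (Fin n) → unitInterval) (F : Finset (Sym2 (Fin n))) {A B : Set (BondConfig (Fin n))}
    (hA : IsUpperSet A) (hB : IsUpperSet B) :
    (∑ O ∈ F.powerset, (∏ f ∈ O, (w f : ℝ)) * (∏ f ∈ F \ O, (1 - (w f : ℝ))) *
        (prodBernoulli (fun f => if f ∈ O then (1 : unitInterval) else if f ∈ F then 0 else w f)).real A) *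
      (∑ O ∈ F.powerset, (∏ f ∈ O, (w f : ℝ)) * (∏ f ∈ F \ O, (1 - (w f : ℝ))) *
        (prodBernoulli (fun f => if f ∈ O then (1 : unitInterval) else if f ∈ F then 0 else w f)).real B) ≤
      ∑ O ∈ F.powerset, (∏ f ∈ O, (w f : ℝ)) * (∏ f ∈ F \ O, (1 - (w f : ℝ))) *
        ((prodBernoulli (fun f => if f ∈ O then (1 : unitInterval) else if f ∈ F then 0 else w f)).real A *
          (prodBernoulli (fun f => if f ∈ O then (1 : unitInterval) else if f ∈ F then 0 else w f)).real B) := by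
  -- extend the weight by zero off the powerset of F and apply Mathlib's FKG inequality on the lattice of all finsets
  set μ : Finset (Sym2 (Fin n)) → ℝ := fun O => if O ⊆ F then (∏ f ∈ O, (w f : ℝ)) * (∏ f ∈ F \ O, (1 - (w f : ℝ))) else 0 with hμ
  set fA : Finset (Sym2 (Fin n)) → ℝ := fun O =>
    (prodBernoulli (fun f => if f ∈ O then (1 : unitInterval) else if f ∈ F then 0 else w f)).real A with hfA
  set fB : Finset (Sym2 (Fin n)) → ℝ := fun O =>
    (prodBernoulli (fun f => if f ∈ O then (1 : unitInterval) else if f ∈ F then 0 else w f)).real B with hfB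
  have hw0 : ∀ O, 0 ≤ (∏ f ∈ O, (w f : ℝ)) * (∏ f ∈ F \ O, (1 - (w f : ℝ))) := fun O =>
    mul_nonneg (Finset.prod_nonneg fun f _ => (w f).2.1) (Finset.prod_nonneg fun f _ => sub_nonneg.2 (w f).2.2)
  have hμ0 : 0 ≤ μ := fun O => by
    simp only [hμ]
    split_ifs
    · exact hw0 O
    · exact le_refl _
  have hfA0 : 0 ≤ fA := fun O => measureReal_nonneg
  have hfB0 : 0 ≤ fB := fun O => measureReal_nonneg
  have hfAm : Monotone fA := fun O O' h => real_pin_mono w F hA h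
  have hfBm : Monotone fB := fun O O' h => real_pin_mono w F hB h
  have hlog : ∀ a b, μ a * μ b ≤ μ (a ⊓ b) * μ (a ⊔ b) := by
    intro a b
    simp only [hμ, Finset.inf_eq_inter, Finset.sup_eq_union]
    by_cases ha : a ⊆ F
    · by_cases hb : b ⊆ F
      · rw [if_pos ha, if_pos hb, if_pos (Finset.inter_subset_left.trans ha), if_pos (Finset.union_subset ha hb),
          mixtureWeight_mul_eq w ha hb]
      · rw [if_neg hb, mul_zero]
        exact mul_nonneg (by split_ifs; exacts [hw0 _, le_refl _]) (by split_ifs; exacts [hw0 _, le_refl _])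
    · rw [if_neg ha, zero_mul]
      exact mul_nonneg (by split_ifs; exacts [hw0 _, le_refl _]) (by split_ifs; exacts [hw0 _, le_refl _])
  have key := fkg (μ := μ) (f := fA) (g := fB) hμ0 hfA0 hfB0 hfAm hfBm hlog
  -- rewrite the sums over all finsets as sums over the powerset of F
  have hsum : ∀ h : Finset (Sym2 (Fin n)) → ℝ, ∑ O, μ O * h O =
      ∑ O ∈ F.powerset, (∏ f ∈ O, (w f : ℝ)) * (∏ f ∈ F \ O, (1 - (w f : ℝ))) * h O := by
    intro h
    rw [← Finset.sum_subset (Finset.subset_univ F.powerset)]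
    · refine Finset.sum_congr rfl fun O hO => ?_
      simp only [hμ, if_pos (Finset.mem_powerset.1 hO)]
    · intro O _ hO
      simp only [hμ, if_neg (fun h' => hO (Finset.mem_powerset.2 h')), zero_mul]
  have hone : ∑ O, μ O = 1 := by
    have := hsum fun _ => 1
    simp only [mul_one] at this
    rw [this, sum_mixtureWeight_eq_one]
  rw [hsum fA, hsum fB, hone, one_mul, hsum (fun O => fA O * fB O)] at key
  exact key

end IncStar

end Summit.CriticalPhenomena.PercolationContinuityZ3.Theorems
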